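import Literature.Analysis.FluidPDE.PassiveVectorTensorBlockIdentity
import Literature.Analysis.FluidPDE.PassiveVectorTensorEnergyDecay
import Literature.Analysis.ODE.TwoPointDampingGronwall
import HarnessLib

/-!
# Weak tensor-viscosity passive-vector solutions: the energy OUTSIDE a finite block of modes stays small when the
# block is spectrally separated (fast-block / corrector-content bound)

Analysis/FluidPDE proof-support file (everything proved; no definitions, no named facts).  Setting: `A = 0`, constant
tensor in a Legendre–Hadamard window `NearIso 𝔸 lo hi`, `0 < lo`, carrier `b` essentially bounded by `M`, datum
`w₀ ∈ L²` weakly divergence free and Fourier-supported in a finite symmetric block `S`.  Suppose that, for a.e. time, every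
mode of the solution OUTSIDE `S` has `|k|² ≥ ρ > 0` (spectral separation — e.g. a Bloch-sector-supported solution of a cell
problem, `S` = the slow modes `{±ℓ}` of the sector, `ρ = n²/4`, `PassiveVectorTensorSymmetry`), and that the block's own
dissipation density is bounded, `4π² Σ_{k∈S} |k|² ‖ŵ(t)(k)‖² ≤ Γ²`.  Then the COMPLEMENT ENERGY
`u(t) = ‖w(t)‖² − Σ_{k∈S} ‖ŵ(t)(k)‖² = ‖w(t) − P_S w(t)‖²` obeys, for a.e. `t`,

  `u(t) ≤ (d·M·Γ)² / (4π² lo ρ)²`   (`ae_complement_energy_le`).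

Mechanism (Robinson–Rodrigo–Sadowski 2016 §4.2 energy method, run on the weak solution): the exact energy equality
(`PassiveVectorTensorEnergyDecay.ae_tendsto_setIntegral_symbForm`) minus the exact block identity
(`PassiveVectorTensorBlockIdentity.ae_block_energy_identity`) gives, between a.e. pairs of times,
`u(t) − u(s) + 2·(complement dissipation) = −2 ∫_{(s,t]} Flux_S`; the complement dissipation is `≥ 4π² lo ρ ∫ u` by the
separation and the coercivity of the symbol (`lo_mul_le_re_inner_symbT`), the flux is `≤ d·M·Γ·√u`
(`ae_blockFlux_eq_remainder`), and the a.e. two-point Grönwall lemma (`Literature.Analysis.ODE.le_div_of_two_point_setIntegral_le`)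
closes.  Consumer: clause (C) (corrector content `≤ C·(c|ℓ|²/(n²ν²))·E₀`) of the K1L tensor cell package
(`CellEnergyClauses`, stub `stub_cellEnergyT` of `LagrangianRenormalisationStep`, route `SolenoidalFractalHomogenisation`,
cell `ad-ideate`): for a single-mode datum `Re e_ℓ·p` along the `1/n`-periodic cell carrier the solution stays in the Bloch
sector `{±ℓ} + nℤ^d` (`PassiveVectorTensorSymmetry.ae_mFourierCoeff_eq_zero_off_sector`), so `S = {ℓ, −ℓ}`, `ρ = n²/4`
(for `|ℓᵢ| ≤ n/2`), `Γ² = 4π²|ℓ|²·‖w₀‖²`, and the bound reads `‖(1 − P_S) w(t)‖² ≤ C·|ℓ|²/(n² ν²)·‖w₀‖²` once `M ∼ 1/n`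
and `lo ∼ ν lo_S/n²` are inserted — the consumer instantiates the constants.

## References

* J. C. Robinson, J. L. Rodrigo, W. Sadowski, *The three-dimensional Navier–Stokes equations* (CUP 2016), §4.2, (4.20). [`RobinsonRodrigoSadowski2016`]
* R. Temam, *Navier–Stokes Equations* (1984), Ch. III §1 Lemma 1.2. [`Temam1984`]
* U. Frisch, *Turbulence* (CUP 1995), §9.6.3 eq. (9.57) p. 233. [`Frisch1995Turbulence`]
-/

noncomputable section

open MeasureTheory Set Filter Function TopologicalSpace Complex UnitAddTorus
open scoped ENNReal NNReal InnerProductSpace ComplexConjugate Topology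

namespace Literature.Analysis.FluidPDE

namespace Torus

variable {d : Type*} [Fintype d] [DecidableEq d]

namespace IsWeakTensorPassiveVectorOn

variable {T : ℝ} {𝔸 : Visc4 d} {b w : ℝ → UnitAddTorus d → EuclideanSpace ℝ d} {w₀ : UnitAddTorus d → EuclideanSpace ℝ d}

/-- **The complement of a spectrally separated block carries little energy.**  `A = 0`, `NearIso 𝔸 lo hi` with `0 < lo`,
carrier essentially bounded by `M`, datum `w₀ ∈ L²` weakly divergence free with Fourier support in the finite symmetric block
`S`.  If for a.e. `t` every mode of `w(t)` outside `S` has `|k|² ≥ ρ` (`0 < ρ`) and the block dissipation density is bounded,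
`4π² Σ_{k∈S}|k|²‖ŵ(t)(k)‖² ≤ Γ²`, then for a.e. `t ∈ (0,T)`
`‖w(t)‖² − Σ_{k∈S}‖ŵ(t)(k)‖² ≤ (d·M·Γ)²/(4π² lo ρ)²`.
[cite: RobinsonRodrigoSadowski2016, §4.2 (4.20)] [cite: Temam1984, Ch. III §1 Lemma 1.2] -/
theorem ae_complement_energy_le (h : IsWeakTensorPassiveVectorOn 0 T 𝔸 b w₀ w)
    {lo hi : ℝ} (h𝔸 : NearIso 𝔸 lo hi) (hlo : 0 < lo)
    (hw₀ : MemLp w₀ 2 volume) (hdiv₀ : FunctionSpaces.Torus.IsWeaklyDivFree w₀)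
    (hb : MemLp (FunctionSpaces.Torus.stLift b) ∞ (volume.restrict (Ioo 0 T ×ˢ univ)))
    {M : ℝ} (hM : 0 ≤ M) (hbM : ∀ᵐ s ∂(volume.restrict (Ioo 0 T)), ∀ᵐ x ∂volume, ‖b s x‖ ≤ M)
    (S : Finset (d → ℤ)) (hS : ∀ k ∈ S, -k ∈ S)
    (hsupp₀ : ∀ k, k ∉ S → mFourierCoeff (FunctionSpaces.EuclideanSpace.complexify ∘ w₀) k = 0)
    {ρ : ℝ} (hρ : 0 < ρ)
    (hgap : ∀ᵐ s ∂(volume.restrict (Ioo 0 T)), ∀ k, k ∉ S →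
      mFourierCoeff (FunctionSpaces.EuclideanSpace.complexify ∘ w s) k ≠ 0 → ρ ≤ FunctionSpaces.Torus.freqNormSq k)
    {Γ : ℝ} (hΓ : 0 ≤ Γ)
    (hslow : ∀ᵐ s ∂(volume.restrict (Ioo 0 T)), 4 * Real.pi ^ 2 * ∑ k ∈ S, FunctionSpaces.Torus.freqNormSq k *
      ‖mFourierCoeff (FunctionSpaces.EuclideanSpace.complexify ∘ w s) k‖ ^ 2 ≤ Γ ^ 2) :
    ∀ᵐ t ∂(volume.restrict (Ioo 0 T)),
      (∫ x, ‖w t x‖ ^ 2) - ∑ k ∈ S, ‖mFourierCoeff (FunctionSpaces.EuclideanSpace.complexify ∘ w t) k‖ ^ 2 ≤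
        (Fintype.card d * M * Γ) ^ 2 / (4 * Real.pi ^ 2 * lo * ρ) ^ 2 := by
  classical
  -- ### notation
  set X : (d → ℤ) → ℝ → EuclideanSpace ℂ d := fun k s =>
    mFourierCoeff (FunctionSpaces.EuclideanSpace.complexify ∘ w s) k with hX
  set X₀ : (d → ℤ) → EuclideanSpace ℂ d := fun k => mFourierCoeff (FunctionSpaces.EuclideanSpace.complexify ∘ w₀) k with hX₀
  set Q : ℕ → ℝ → ℝ := fun N s => 4 * Real.pi ^ 2 * ∑ k ∈ FunctionSpaces.Torus.freqBall N,
    (⟪X k s, symbT 𝔸 k (X k s)⟫_ℂ).re with hQ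
  set QS : ℝ → ℝ := fun s => 4 * Real.pi ^ 2 * ∑ k ∈ S, (⟪X k s, symbT 𝔸 k (X k s)⟫_ℂ).re with hQS
  set FS : ℝ → ℝ := fun s =>
    (∫ x, ⟪w s x, FunctionSpaces.Torus.convect (b s) (FunctionSpaces.Torus.realTrigPoly S (fun k => X k s)) x⟫_ℝ) +
      (0 : ℝ) * ∫ x, ⟪b s x, FunctionSpaces.Torus.convect (w s) (FunctionSpaces.Torus.realTrigPoly S (fun k => X k s)) x⟫_ℝ
    with hFS
  set E : ℝ → ℝ := fun s => ∫ x, ‖w s x‖ ^ 2 with hE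
  set E₀ : ℝ := ∫ x, ‖w₀ x‖ ^ 2 with hE₀
  set ES : ℝ → ℝ := fun s => ∑ k ∈ S, ‖X k s‖ ^ 2 with hES
  set u : ℝ → ℝ := fun s => E s - ES s with hu
  set lam : ℝ := 4 * Real.pi ^ 2 * lo * ρ with hlam
  set κ : ℝ := Fintype.card d * M * Γ with hκ
  have hlam0 : 0 < lam := by positivity
  have hκ0 : 0 ≤ κ := by positivity
  set Qs : ℝ → ℝ≥0∞ := fun s => ⨆ N : ℕ, ENNReal.ofReal (Q N s) with hQs
  -- ### integrability
  have hQint : ∀ N, IntegrableOn (Q N) (Ioo 0 T) := fun N => h.integrableOn_symbForm N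
  have hQSint : IntegrableOn QS (Ioo 0 T) := h.integrableOn_blockSymbForm S
  have hFSint : IntegrableOn FS (Ioo 0 T) := h.integrableOn_blockFlux S
  have hEint : IntegrableOn E (Ioo 0 T) := h.integrableOn_integral_norm_sq
  have hESint : IntegrableOn ES (Ioo 0 T) := integrable_finsetSum _ fun k _ => h.integrableOn_norm_sq_mFourierCoeff k
  have huint : IntegrableOn u (Ioo 0 T) := hEint.sub hESint
  -- ### a.e.-in-`s` facts
  have hmono : ∀ᵐ s ∂(volume.restrict (Ioo 0 T)), Monotone fun N : ℕ => Q N s := h.ae_symbForm_mono h𝔸 hlo.le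
  have hnn : ∀ᵐ s ∂(volume.restrict (Ioo 0 T)), ∀ k : d → ℤ, 0 ≤ (⟪X k s, symbT 𝔸 k (X k s)⟫_ℂ).re :=
    h.ae_re_inner_symbT_nonneg h𝔸 hlo.le
  have hQnn : ∀ᵐ s ∂(volume.restrict (Ioo 0 T)), ∀ N, 0 ≤ Q N s := by
    filter_upwards [hnn] with s hs
    intro N
    exact mul_nonneg (by positivity) (Finset.sum_nonneg fun k _ => hs k)
  have hQSnn : ∀ᵐ s ∂(volume.restrict (Ioo 0 T)), 0 ≤ QS s := by
    filter_upwards [hnn] with s hs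
    exact mul_nonneg (by positivity) (Finset.sum_nonneg fun k _ => hs k)
  have htr := ae_all_iff.2 fun k => h.ae_sum_mul_mFourierCoeff_eq_zero k
  -- `u = ‖w − P_S w‖² ≥ 0` at a.e. `s`
  have hupars : ∀ᵐ s ∂(volume.restrict (Ioo 0 T)),
      ∫ x, ‖w s x - FunctionSpaces.Torus.realTrigPoly S (fun k => X k s) x‖ ^ 2 = u s := by
    filter_upwards [h.ae_memLp_two] with s hs2
    exact integral_norm_sq_sub_realTrigPoly_coeff hS hs2
  have hunn : ∀ᵐ s ∂(volume.restrict (Ioo 0 T)), 0 ≤ u s := by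
    filter_upwards [hupars] with s hs
    rw [← hs]
    exact integral_nonneg fun x => sq_nonneg _
  -- ### (S4) the separation: `ofReal (QS s + lam · u s) ≤ Qs s` for a.e. `s`
  obtain ⟨N₀, hN₀⟩ : ∃ N₀ : ℕ, S ⊆ FunctionSpaces.Torus.freqBall N₀ := by
    have hk : ∀ k ∈ S, ∃ N : ℕ, k ∈ FunctionSpaces.Torus.freqBall N := fun k _ => FunctionSpaces.Torus.exists_mem_freqBall k
    choose! N hN using hk
    refine ⟨S.sup N, fun k hk => FunctionSpaces.Torus.freqBall_mono (Finset.le_sup hk) (hN k hk)⟩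
  have hlow : ∀ᵐ s ∂(volume.restrict (Ioo 0 T)), ENNReal.ofReal (QS s + lam * u s) ≤ Qs s := by
    filter_upwards [hnn, htr, hgap, h.ae_memLp_two] with s hs htrs hgs hs2
    -- per mode outside `S`: `lo ρ ‖X‖² ≤ Re ⟪X, T X⟫`
    have hmode : ∀ k, k ∉ S → lo * ρ * ‖X k s‖ ^ 2 ≤ (⟪X k s, symbT 𝔸 k (X k s)⟫_ℂ).re := by
      intro k hk
      by_cases hz : X k s = 0
      · rw [hz, norm_zero]; simp
      · have h1 := lo_mul_le_re_inner_symbT h𝔸 (htrs k)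
        have h2 : lo * ρ * ‖X k s‖ ^ 2 ≤ lo * (FunctionSpaces.Torus.freqNormSq k * ‖X k s‖ ^ 2) := by
          rw [mul_assoc]
          exact mul_le_mul_of_nonneg_left (mul_le_mul_of_nonneg_right (hgs k hk hz) (sq_nonneg _)) hlo.le
        exact h2.trans h1
    -- for `N ≥ N₀`: `QS s + lam (Σ_ball ‖X‖² − ES s) ≤ Q N s`
    have hN : ∀ N, N₀ ≤ N → QS s + lam * ((∑ k ∈ FunctionSpaces.Torus.freqBall N, ‖X k s‖ ^ 2) - ES s) ≤ Q N s := by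
      intro N hNN
      have hsub : S ⊆ FunctionSpaces.Torus.freqBall N := hN₀.trans (FunctionSpaces.Torus.freqBall_mono hNN)
      have e1 := Finset.sum_sdiff hsub (f := fun k => (⟪X k s, symbT 𝔸 k (X k s)⟫_ℂ).re)
      have e2 := Finset.sum_sdiff hsub (f := fun k => ‖X k s‖ ^ 2)
      have h3 : lo * ρ * ∑ k ∈ FunctionSpaces.Torus.freqBall N \ S, ‖X k s‖ ^ 2 ≤
          ∑ k ∈ FunctionSpaces.Torus.freqBall N \ S, (⟪X k s, symbT 𝔸 k (X k s)⟫_ℂ).re := by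
        rw [Finset.mul_sum]
        exact Finset.sum_le_sum fun k hk => hmode k (Finset.mem_sdiff.1 hk).2
      rw [hQS, hQ, hES, hlam]
      simp only
      rw [← e1, ← e2]
      nlinarith [h3, Real.pi_pos]
    have hEN : Tendsto (fun N => QS s + lam * ((∑ k ∈ FunctionSpaces.Torus.freqBall N, ‖X k s‖ ^ 2) - ES s)) atTop
        (𝓝 (QS s + lam * (E s - ES s))) :=
      ((((FunctionSpaces.Torus.hasSum_sq_norm_mFourierCoeff_complexify hs2).comp
        FunctionSpaces.Torus.tendsto_freqBall_atTop).sub_const (ES s)).const_mul lam).const_add (QS s)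
    have hEN' := ENNReal.tendsto_ofReal hEN
    refine le_of_tendsto hEN' ?_
    filter_upwards [eventually_ge_atTop N₀] with N hNN
    exact (ENNReal.ofReal_le_ofReal (hN N hNN)).trans (le_iSup (fun N : ℕ => ENNReal.ofReal (Q N s)) N)
  have hQm : ∀ N, AEMeasurable (fun s => ENNReal.ofReal (Q N s)) (volume.restrict (Ioo 0 T)) := fun N =>
    (hQint N).aestronglyMeasurable.aemeasurable.ennreal_ofReal
  -- ### (S1) the energy identity with `Qs`, at a.e. `t`
  have hEq : ∀ᵐ t ∂(volume.restrict (Ioo 0 T)), ∫⁻ s in Ioc 0 t, Qs s = ENNReal.ofReal ((E₀ - E t) / 2) := by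
    filter_upwards [h.ae_tendsto_setIntegral_symbForm h𝔸 hlo hw₀ hdiv₀ hb, ae_restrict_mem measurableSet_Ioo] with t ht htI
    have hsub : Ioc 0 t ⊆ Ioo 0 T := Ioc_subset_Ioo_right htI.2
    have hmc : ∫⁻ s in Ioc 0 t, Qs s = ⨆ N : ℕ, ∫⁻ s in Ioc 0 t, ENNReal.ofReal (Q N s) := by
      rw [hQs]
      exact lintegral_iSup' (fun N => (hQm N).mono_measure (Measure.restrict_mono hsub le_rfl))
        (ae_restrict_of_ae_restrict_of_subset hsub (hmono.mono fun s hs N N' hNN' => ENNReal.ofReal_le_ofReal (hs hNN')))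
    have heq : ∀ N, ∫⁻ s in Ioc 0 t, ENNReal.ofReal (Q N s) = ENNReal.ofReal (∫ s in Ioc 0 t, Q N s) := fun N =>
      (ofReal_integral_eq_lintegral_ofReal ((hQint N).mono_set hsub)
        (ae_restrict_of_ae_restrict_of_subset hsub (hQnn.mono fun s hs => hs N))).symm
    simp_rw [heq] at hmc
    rw [hmc]
    have hmono' : Monotone fun N : ℕ => ENNReal.ofReal (∫ s in Ioc 0 t, Q N s) := by
      intro N N' hNN'
      refine ENNReal.ofReal_le_ofReal (integral_mono_ae ((hQint N).mono_set hsub) ((hQint N').mono_set hsub) ?_)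
      exact ae_restrict_of_ae_restrict_of_subset hsub (hmono.mono fun s hs => hs hNN')
    have h1 : Tendsto (fun N : ℕ => ENNReal.ofReal (∫ s in Ioc 0 t, Q N s)) atTop
        (𝓝 (⨆ N : ℕ, ENNReal.ofReal (∫ s in Ioc 0 t, Q N s))) := tendsto_atTop_iSup hmono'
    have h2 := ENNReal.tendsto_ofReal ht
    exact tendsto_nhds_unique h1 h2
  -- ### (S2) the block identity at a.e. `t`, with `Σ_S ‖X₀‖² = E₀`
  have hdat : ∑ k ∈ S, ‖X₀ k‖ ^ 2 = E₀ := by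
    have hsum := FunctionSpaces.Torus.hasSum_sq_norm_mFourierCoeff_complexify hw₀
    have hfin : HasSum (fun k : d → ℤ => ‖X₀ k‖ ^ 2) (∑ k ∈ S, ‖X₀ k‖ ^ 2) :=
      hasSum_sum_of_ne_finset_zero fun k hk => by rw [hX₀]; simp only; rw [hsupp₀ k hk, norm_zero]; simp
    exact hfin.unique hsum ▸ rfl
  have hblock : ∀ᵐ t ∂(volume.restrict (Ioo 0 T)), ES t + 2 * ∫ s in Ioc 0 t, QS s = E₀ + 2 * ∫ s in Ioc 0 t, FS s := by
    filter_upwards [h.ae_block_energy_identity hw₀ hdiv₀] with t ht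
    have := ht S
    rw [hdat] at this
    simpa only [hES, hQS, hFS, hX] using this
  -- ### (S8) the flux bound `|FS r| ≤ κ √(u r)` a.e.
  have hflux : ∀ᵐ r ∂(volume.restrict (Ioo 0 T)), |FS r| ≤ κ * Real.sqrt (u r) := by
    filter_upwards [h.ae_blockFlux_eq_remainder hM hbM, hupars, hslow] with r hr hpr hsl
    obtain ⟨hreq, hrle⟩ := hr S hS
    rw [hFS]
    simp only
    rw [hreq]
    refine hrle.trans ?_
    rw [hpr, hκ]
    have h1 : Real.sqrt (4 * Real.pi ^ 2 * ∑ k ∈ S, FunctionSpaces.Torus.freqNormSq k * ‖X k r‖ ^ 2) ≤ Γ := by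
      rw [← Real.sqrt_sq hΓ]
      exact Real.sqrt_le_sqrt hsl
    have h2 : 0 ≤ Fintype.card d * M * Real.sqrt (u r) := by positivity
    calc Fintype.card d * M * Real.sqrt (u r) *
          Real.sqrt (4 * Real.pi ^ 2 * ∑ k ∈ S, FunctionSpaces.Torus.freqNormSq k * ‖X k r‖ ^ 2)
        ≤ Fintype.card d * M * Real.sqrt (u r) * Γ := mul_le_mul_of_nonneg_left h1 h2
      _ = Fintype.card d * M * Γ * Real.sqrt (u r) := by ring
  -- ### the good set of times
  set G : Set ℝ := {t | t ∈ Ioo 0 T ∧ (∫⁻ s in Ioc 0 t, Qs s = ENNReal.ofReal ((E₀ - E t) / 2)) ∧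
    (ES t + 2 * ∫ s in Ioc 0 t, QS s = E₀ + 2 * ∫ s in Ioc 0 t, FS s) ∧ 0 ≤ u t ∧ E t ≤ E₀} with hG_def
  have hEle : ∀ᵐ s ∂(volume.restrict (Ioo 0 T)), E s ≤ E₀ := by
    filter_upwards [h.ae_energy_ineq h𝔸 hlo hw₀ hdiv₀ hb] with s hs
    have h1 : ENNReal.ofReal (E s) ≤ ENNReal.ofReal E₀ := le_trans le_self_add hs
    exact (ENNReal.ofReal_le_ofReal_iff (integral_nonneg fun x => sq_nonneg _)).1 h1
  have hGae : ∀ᵐ t ∂(volume.restrict (Ioo 0 T)), t ∈ G := by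
    filter_upwards [ae_restrict_mem measurableSet_Ioo, hEq, hblock, hunn, hEle] with t h1 h2 h3 h4 h5
    exact ⟨h1, h2, h3, h4, h5⟩
  have hGsub : G ⊆ Ioo 0 T := fun t ht => ht.1
  -- a.e. statements transferred to `volume`
  have hlow' : ∀ᵐ s ∂(volume : Measure ℝ), s ∈ Ioo 0 T → ENNReal.ofReal (QS s + lam * u s) ≤ Qs s :=
    (ae_restrict_iff' measurableSet_Ioo).1 hlow
  have hflux' : ∀ᵐ r ∂(volume : Measure ℝ), r ∈ Ioo 0 T → |FS r| ≤ κ * Real.sqrt (u r) :=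
    (ae_restrict_iff' measurableSet_Ioo).1 hflux
  have hunn' : ∀ᵐ r ∂(volume : Measure ℝ), r ∈ Ioo 0 T → 0 ≤ u r := (ae_restrict_iff' measurableSet_Ioo).1 hunn
  have hQSnn' : ∀ᵐ r ∂(volume : Measure ℝ), r ∈ Ioo 0 T → 0 ≤ QS r := (ae_restrict_iff' measurableSet_Ioo).1 hQSnn
  -- ### (S5) complement dissipation between `s ≤ t`: `∫_{(s,t]} (QS + lam u) ≤ (E s − E t)/2 − ... `
  -- key increment inequality on a subinterval `(a, t] ⊆ (0, T)` with `0 ≤ a`: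
  have hinc : ∀ a t, 0 ≤ a → a ≤ t → t < T → (∫⁻ r in Ioc a t, Qs r) ≠ ⊤ →
      ∫ r in Ioc a t, (QS r + lam * u r) ≤ (∫⁻ r in Ioc a t, Qs r).toReal := by
    intro a t ha hat htT hfin
    have hsub : Ioc a t ⊆ Ioo 0 T := fun r hr => ⟨ha.trans_lt hr.1, hr.2.trans_lt htT⟩
    have hi : IntegrableOn (fun r => QS r + lam * u r) (Ioc a t) := (hQSint.add (huint.const_mul lam)).mono_set hsub
    have hnn' : 0 ≤ᵐ[volume.restrict (Ioc a t)] fun r => QS r + lam * u r := by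
      filter_upwards [ae_restrict_of_ae_restrict_of_subset hsub hQSnn, ae_restrict_of_ae_restrict_of_subset hsub hunn]
        with r h1 h2
      exact add_nonneg h1 (mul_nonneg hlam0.le h2)
    have e := ofReal_integral_eq_lintegral_ofReal hi hnn'
    have hle : ∫⁻ r in Ioc a t, ENNReal.ofReal (QS r + lam * u r) ≤ ∫⁻ r in Ioc a t, Qs r :=
      lintegral_mono_ae (ae_restrict_of_ae_restrict_of_subset hsub hlow)
    rw [← e] at hle
    exact (ENNReal.ofReal_le_iff_le_toReal hfin).1 hle
  -- ### the two-point inequality `u t − u s ≤ ∫_{(s,t]} (κ²/lam − lam u)`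
  have hpt : ∀ r, 0 ≤ u r → 2 * (κ * Real.sqrt (u r)) - 2 * lam * u r ≤ κ ^ 2 / lam - lam * u r := by
    intro r hr
    have hsq : Real.sqrt (u r) ^ 2 = u r := Real.sq_sqrt hr
    have : 0 ≤ (κ / lam - Real.sqrt (u r)) ^ 2 * lam := mul_nonneg (sq_nonneg _) hlam0.le
    have hl : lam ≠ 0 := hlam0.ne'
    field_simp
    nlinarith [hsq, this, sq_nonneg (κ - lam * Real.sqrt (u r)), hlam0]
  have h2pt : ∀ s ∈ G, ∀ t ∈ G, s ≤ t → u t - u s ≤ ∫ r in Ioc s t, (κ ^ 2 / lam - lam * u r) := by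
    intro s hs t ht hst
    obtain ⟨hsI, hEqs, hbls, _, hEs⟩ := hs
    obtain ⟨htI, hEqt, hblt, _, hEt⟩ := ht
    have hs0 : 0 ≤ s := hsI.1.le
    have hsubst : Ioc s t ⊆ Ioo 0 T := fun r hr => ⟨hsI.1.trans hr.1, hr.2.trans_lt htI.2⟩
    -- lintegral additivity `(0,t] = (0,s] ∪ (s,t]`
    have hunion : ∫⁻ r in Ioc 0 t, Qs r = (∫⁻ r in Ioc 0 s, Qs r) + ∫⁻ r in Ioc s t, Qs r := by
      rw [← Ioc_union_Ioc_eq_Ioc hs0 hst, lintegral_union measurableSet_Ioc (Ioc_disjoint_Ioc_of_le le_rfl)]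
    have hfin_t : ∫⁻ r in Ioc 0 t, Qs r ≠ ⊤ := by rw [hEqt]; exact ENNReal.ofReal_ne_top
    have hfin_st : ∫⁻ r in Ioc s t, Qs r ≠ ⊤ := ne_top_of_le_ne_top hfin_t (hunion ▸ le_add_self)
    have hfin_s : ∫⁻ r in Ioc 0 s, Qs r ≠ ⊤ := by rw [hEqs]; exact ENNReal.ofReal_ne_top
    -- `(E s − E t)/2 = (∫⁻_{(s,t]} Qs).toReal`
    have hdiff : (∫⁻ r in Ioc s t, Qs r).toReal = (E s - E t) / 2 := by
      have e1 := congrArg ENNReal.toReal hunion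
      rw [ENNReal.toReal_add hfin_s hfin_st, hEqt, hEqs, ENNReal.toReal_ofReal (by linarith),
        ENNReal.toReal_ofReal (by linarith)] at e1
      linarith
    have hA := hinc s t hs0 hst htI.2 hfin_st
    rw [hdiff] at hA
    -- block increments: integrals over `(0,t]` minus `(0,s]`
    have hsplitQ : ∫ r in Ioc 0 t, QS r = (∫ r in Ioc 0 s, QS r) + ∫ r in Ioc s t, QS r := by
      rw [← setIntegral_union (Ioc_disjoint_Ioc_of_le le_rfl) measurableSet_Ioc
        (hQSint.mono_set (fun r hr => ⟨hr.1, hr.2.trans_lt hsI.2⟩)) (hQSint.mono_set hsubst),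
        Ioc_union_Ioc_eq_Ioc hs0 hst]
    have hsplitF : ∫ r in Ioc 0 t, FS r = (∫ r in Ioc 0 s, FS r) + ∫ r in Ioc s t, FS r := by
      rw [← setIntegral_union (Ioc_disjoint_Ioc_of_le le_rfl) measurableSet_Ioc
        (hFSint.mono_set (fun r hr => ⟨hr.1, hr.2.trans_lt hsI.2⟩)) (hFSint.mono_set hsubst),
        Ioc_union_Ioc_eq_Ioc hs0 hst]
    -- the flux integral is bounded by `∫ κ √u`
    have hFi : IntegrableOn FS (Ioc s t) := hFSint.mono_set hsubst
    have hsqi : IntegrableOn (fun r => κ * Real.sqrt (u r)) (Ioc s t) := by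
      have hm : AEStronglyMeasurable (fun r => κ * Real.sqrt (u r)) (volume.restrict (Ioc s t)) :=
        (Real.continuous_sqrt.comp_aestronglyMeasurable (huint.mono_set hsubst).aestronglyMeasurable).const_mul κ
      refine Integrable.mono' (((huint.mono_set hsubst).add (integrableOn_const (C := (1:ℝ)) (by simp))).const_mul κ) hm ?_
      filter_upwards [ae_restrict_of_ae_restrict_of_subset hsubst hunn] with r hr
      rw [Real.norm_eq_abs, abs_of_nonneg (mul_nonneg hκ0 (Real.sqrt_nonneg _))]
      refine mul_le_mul_of_nonneg_left ?_ hκ0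
      show Real.sqrt (u r) ≤ u r + 1
      nlinarith [Real.sqrt_nonneg (u r), Real.sq_sqrt hr, sq_nonneg (Real.sqrt (u r) - 1)]
    have hFle : |∫ r in Ioc s t, FS r| ≤ ∫ r in Ioc s t, κ * Real.sqrt (u r) := by
      refine (abs_integral_le_integral_abs).trans (integral_mono_ae hFi.abs hsqi ?_)
      exact ae_restrict_of_ae_restrict_of_subset hsubst hflux
    -- assemble
    have hui : IntegrableOn u (Ioc s t) := huint.mono_set hsubst
    have hgoal : u t - u s ≤ ∫ r in Ioc s t, (2 * (κ * Real.sqrt (u r)) - 2 * lam * u r) := by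
      have hQl : ∫ r in Ioc s t, (QS r + lam * u r) = (∫ r in Ioc s t, QS r) + lam * ∫ r in Ioc s t, u r := by
        rw [integral_add (hQSint.mono_set hsubst) (hui.const_mul lam), integral_const_mul lam]
      rw [integral_sub (hsqi.const_mul 2) (hui.const_mul (2 * lam)), integral_const_mul 2, integral_const_mul (2 * lam)]
      rw [hQl] at hA
      have hut : u t = E t - ES t := rfl
      have hus : u s = E s - ES s := rfl
      have habs := abs_le.1 hFle
      rw [hsplitQ] at hblt
      rw [hsplitF] at hblt
      linarith [habs.1, habs.2]
    refine hgoal.trans (integral_mono_ae ((hsqi.const_mul 2).sub (hui.const_mul (2 * lam)))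
      ((integrableOn_const (C := κ ^ 2 / lam) (by simp)).sub (hui.const_mul lam)) ?_)
    filter_upwards [ae_restrict_of_ae_restrict_of_subset hsubst hunn] with r hr
    exact hpt r hr
  -- ### the inequality from `0`
  have h0pt : ∀ t ∈ G, u t ≤ ∫ r in Ioc 0 t, (κ ^ 2 / lam - lam * u r) := by
    intro t ht
    obtain ⟨htI, hEqt, hblt, _, hEt⟩ := ht
    have hsubt : Ioc 0 t ⊆ Ioo 0 T := Ioc_subset_Ioo_right htI.2
    have hfin_t : ∫⁻ r in Ioc 0 t, Qs r ≠ ⊤ := by rw [hEqt]; exact ENNReal.ofReal_ne_top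
    have hA := hinc 0 t le_rfl htI.1.le htI.2 hfin_t
    rw [hEqt, ENNReal.toReal_ofReal (by linarith)] at hA
    have hFi : IntegrableOn FS (Ioc 0 t) := hFSint.mono_set hsubt
    have hsqi : IntegrableOn (fun r => κ * Real.sqrt (u r)) (Ioc 0 t) := by
      have hm : AEStronglyMeasurable (fun r => κ * Real.sqrt (u r)) (volume.restrict (Ioc 0 t)) :=
        (Real.continuous_sqrt.comp_aestronglyMeasurable (huint.mono_set hsubt).aestronglyMeasurable).const_mul κ
      refine Integrable.mono' (((huint.mono_set hsubt).add (integrableOn_const (C := (1:ℝ)) (by simp))).const_mul κ) hm ?_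
      filter_upwards [ae_restrict_of_ae_restrict_of_subset hsubt hunn] with r hr
      rw [Real.norm_eq_abs, abs_of_nonneg (mul_nonneg hκ0 (Real.sqrt_nonneg _))]
      refine mul_le_mul_of_nonneg_left ?_ hκ0
      show Real.sqrt (u r) ≤ u r + 1
      nlinarith [Real.sqrt_nonneg (u r), Real.sq_sqrt hr, sq_nonneg (Real.sqrt (u r) - 1)]
    have hFle : |∫ r in Ioc 0 t, FS r| ≤ ∫ r in Ioc 0 t, κ * Real.sqrt (u r) := by
      refine (abs_integral_le_integral_abs).trans (integral_mono_ae hFi.abs hsqi ?_)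
      exact ae_restrict_of_ae_restrict_of_subset hsubt hflux
    have hui : IntegrableOn u (Ioc 0 t) := huint.mono_set hsubt
    have hgoal : u t ≤ ∫ r in Ioc 0 t, (2 * (κ * Real.sqrt (u r)) - 2 * lam * u r) := by
      have hQl : ∫ r in Ioc 0 t, (QS r + lam * u r) = (∫ r in Ioc 0 t, QS r) + lam * ∫ r in Ioc 0 t, u r := by
        rw [integral_add (hQSint.mono_set hsubt) (hui.const_mul lam), integral_const_mul lam]
      rw [integral_sub (hsqi.const_mul 2) (hui.const_mul (2 * lam)), integral_const_mul 2, integral_const_mul (2 * lam)]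
      rw [hQl] at hA
      have hut : u t = E t - ES t := rfl
      have habs := abs_le.1 hFle
      linarith [habs.1, habs.2]
    refine hgoal.trans (integral_mono_ae ((hsqi.const_mul 2).sub (hui.const_mul (2 * lam)))
      ((integrableOn_const (C := κ ^ 2 / lam) (by simp)).sub (hui.const_mul lam)) ?_)
    filter_upwards [ae_restrict_of_ae_restrict_of_subset hsubt hunn] with r hr
    exact hpt r hr
  -- ### Grönwall damping
  have hK : 0 ≤ κ ^ 2 / lam := div_nonneg (sq_nonneg _) hlam0.le
  have hres := Literature.Analysis.ODE.le_div_of_two_point_setIntegral_le hlam0 hK hGsub hGae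
    (fun r hr => hr.2.2.2.1) huint h0pt h2pt
  filter_upwards [hGae] with t ht
  have := hres t ht
  have e : κ ^ 2 / lam / lam = κ ^ 2 / lam ^ 2 := by rw [div_div, sq lam]
  rw [hκ, hlam] at this e
  rw [e] at this
  exact this

end IsWeakTensorPassiveVectorOn

end Torus

end Literature.Analysis.FluidPDE

end
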